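import Summits.KontsevichZagierPeriods.KontsevichZagierPeriods.Theorems.RootDecompQuadraticDescentPair18ReductionP6

/-! # `RootDecompQuadraticDescentPair18ReductionP7` — part 7/7 of the mechanical ≤400-line split of `Pair18Reduction_v5_landing.lean` (sha256 0a10c70876ba8bf2…)
Source: decomp-kz lens-6 g8 `Pair18Reduction.lean` v5 (HOME/decomp-kz-lens-6/g8/, sha256 9036e907…; critic g3 CLEARED 12:08:58Z/13:14:52Z): census pair #18 reduced to strips — `pair18_iff_strips : KZ.of A18.rep − 2 • KZ.of B18.rep ∈ KZ.relations ↔ [U1] − [U2r] + [SL] − 2•[K12c] + 2•[Kh] ∈ KZ.relations` (namespace …RootDecompQuadraticDescent.Pair18); `#print axioms` pins removed for landing.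
Split by census-1 g9 `gen/splitlean.py`: scopes re-opened with their `open`/`variable`/`set_option` context; mathematics and declaration order unchanged. -/

noncomputable section
open MeasureTheory Set MvPolynomial
namespace Summit.KontsevichZagierPeriods.RootDecompQuadraticDescent.Pair18
open Literature.NumberTheory.Transcendental
open Literature.NumberTheory.Transcendental.KZ
open Literature.ModelTheory.ExponentialFields (IsSemialgebraic continuous_aeval_real)
open Summit.KontsevichZagierPeriods.RootDecompQuadraticDescent.DarkPairs (rel_reflect_rep rel_double
  update_one_apply_zero one_div_eq_mul_one_div)
/-- **Affine substitution in the plane.**  `Φ(z) = M z + v` with `M ∈ GL₂(ℚ)`: if `Φ` maps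
`r.domain` onto `r'.domain` and `f = (f' ∘ Φ)·|det M|` on `r.domain`, then `[r] − [r'] ∈ KZ.relations`.
[cite: KontsevichZagier2001, §1.2 rule 2] -/
private theorem rel_affine (r r' : KZ.IntegralRep 2) (M : Matrix (Fin 2) (Fin 2) ℚ) (v : Fin 2 → ℚ)
    (Φ : (Fin 2 → ℝ) → (Fin 2 → ℝ))
    (hΦ : ∀ z i, Φ z i = (M i 0 : ℝ) * z 0 + (M i 1 : ℝ) * z 1 + (v i : ℝ))
    (hdet : M.det ≠ 0) (himg : r'.domain = Φ '' r.domain)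
    (hint : ∀ z ∈ r.domain, r.integrand z = r'.integrand (Φ z) * |(M.det : ℝ)|) :
    KZ.of r - KZ.of r' ∈ KZ.relations := by
  let Mr : Matrix (Fin 2) (Fin 2) ℝ := fun i j => (M i j : ℝ)
  let Lr : (Fin 2 → ℝ) →ₗ[ℝ] (Fin 2 → ℝ) := Matrix.toLin' Mr
  let Φ' : (Fin 2 → ℝ) → (Fin 2 → ℝ) →L[ℝ] (Fin 2 → ℝ) := fun _ => LinearMap.toContinuousLinearMap Lr
  have hLr : ∀ z, Lr z = fun i => (M i 0 : ℝ) * z 0 + (M i 1 : ℝ) * z 1 := by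
    intro z; funext i; simp [Lr, Mr, Matrix.toLin'_apply, Matrix.mulVec, dotProduct, Fin.sum_univ_two]
  have hΦL : Φ = fun z => Lr z + fun i => (v i : ℝ) := by
    funext z; funext i; rw [hΦ, Pi.add_apply, hLr]
  have hdetR : Mr.det = (M.det : ℝ) := by
    rw [Matrix.det_fin_two, Matrix.det_fin_two]; push_cast; simp [Mr]
  have hdet' : ∀ z, (Φ' z).det = (M.det : ℝ) := by
    intro z; rw [← hdetR]; unfold ContinuousLinearMap.det; simp [Φ', Lr, LinearMap.det_toLin']
  have hdetR' : ((M 0 0 * M 1 1 - M 0 1 * M 1 0 : ℚ) : ℝ) ≠ 0 := by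
    rw [← Matrix.det_fin_two]; exact_mod_cast hdet
  refine KZ.changeOfVariablesRel_subset_relations ⟨2, r, r', Φ, Φ', ?_, ?_, ?_, himg, ?_, rfl⟩
  · refine (isSemialgebraicMapOn_iff_forall_holds r.isSemialgebraic_domain).mpr fun i => ?_
    exact (isSemialgebraicFunOn_aeval r.isSemialgebraic_domain
      (C (M i 0) * X 0 + C (M i 1) * X 1 + C (v i))).congr fun z _ => by
        simp only [map_add, map_mul, aeval_C, aeval_X, eq_ratCast, hΦ]
  · intro z _
    rw [hΦL]; have h := ((LinearMap.toContinuousLinearMap Lr).hasFDerivAt (x := z)).add_const (fun i => (v i : ℝ))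
    simpa [Φ'] using h.hasFDerivWithinAt
  · intro z₁ _ z₂ _ h
    have e1 := congrFun h 0; have e2 := congrFun h 1; simp only [hΦ] at e1 e2
    have hx : ((M 0 0 * M 1 1 - M 0 1 * M 1 0 : ℚ) : ℝ) * (z₁ 0 - z₂ 0) = 0 := by
      push_cast; linear_combination (M 1 1 : ℝ) * e1 - (M 0 1 : ℝ) * e2
    have hy : ((M 0 0 * M 1 1 - M 0 1 * M 1 0 : ℚ) : ℝ) * (z₁ 1 - z₂ 1) = 0 := by
      push_cast; linear_combination (M 0 0 : ℝ) * e2 - (M 1 0 : ℝ) * e1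
    rcases mul_eq_zero.1 hx with h1 | h1
    · exact absurd h1 hdetR'
    rcases mul_eq_zero.1 hy with h2 | h2
    · exact absurd h2 hdetR'
    funext i; fin_cases i
    · exact sub_eq_zero.1 h1
    · exact sub_eq_zero.1 h2
  · intro z hz
    rw [hint z hz, hdet' z]

/-- Auxiliary step `snoc2_zero` (§1): snoc2 zero. [bookkeeping] -/
@[simp] private theorem snoc2_zero (x : Fin 1 → ℝ) (t : ℝ) : (Fin.snoc x t : Fin 2 → ℝ) 0 = x 0 := rfl

/-- Auxiliary step `snoc2_one` (§1): snoc2 one. [bookkeeping] -/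
@[simp] private theorem snoc2_one (x : Fin 1 → ℝ) (t : ℝ) : (Fin.snoc x t : Fin 2 → ℝ) 1 = t := rfl

/-- Auxiliary step `init2_zero` (§1): init2 zero. [bookkeeping] -/
@[simp] private theorem init2_zero (z : Fin 2 → ℝ) : Fin.init z 0 = z 0 := rfl

/-- (u4) the increasing affine fibre map `σ = (1 − w)/2 + (1 + w)τ/2`: `U1hi ≡ U2r`. -/
theorem u1hi_U2r : KZ.of U1hi - KZ.of U2r.rep ∈ KZ.relations := by
  have hB : IsSemialgebraic ℚ U1hi.domain := U1hi.isSemialgebraic_domain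
  have hmem : ∀ z ∈ U1hi.domain, (0 : ℝ) ≤ z 0 ∧ (1 - z 0) / 2 ≤ z 1 ∧ z 1 ≤ 1 := fun z hz => by
    have hz' : z ∈ sbDom hoE oneE := hz
    obtain ⟨⟨h0, _⟩, h1, h2⟩ := mem_sbDom.1 hz'
    simp only [hoE_f, oneE_f] at h1 h2
    exact ⟨h0, h1, h2⟩
  refine of_sub_of_mem_relations_of_fibreMap (G := ivl 0 1) (a := fun y => hoE.f (y 0))
    (b := fun y => oneE.f (y 0)) (a' := fun y => zeroE.f (y 0)) (b' := fun y => oneE.f (y 0))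
    (fun z => (2 * z 1 - 1 + z 0) / (1 + z 0)) (fun z => 2 / (1 + z 0)) U1hi U2r.rep rfl
    (by rw [RFun.rep_domain, cube_eq_sbDom]; rfl) (fun y hy => ?_) ?_ ?_ ?_ ?_ ?_ ?_ ?_
  · simp only [hoE_f, oneE_f]; linarith [(I01 hy).1]
  · have h := isSemialgebraicFunOn_aeval_div_aeval hB (2 * X 1 - 1 + X 0 : MvPolynomial (Fin 2) ℚ)
      (1 + X 0) fun z hz => by
        have h0 := (hmem z hz).1
        simp only [map_add, map_one, aeval_X]; positivity
    exact h.congr fun z _ => by simp only [map_add, map_sub, map_mul, map_ofNat, map_one, aeval_X]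
  · intro z hz
    have h0 := (hmem z hz).1
    have h1 : (1 : ℝ) + z 0 ≠ 0 := by positivity
    fun_prop (disch := assumption)
  · intro z hz
    show HasDerivAt (fun t => (2 * (Fin.snoc (Fin.init z) t : Fin 2 → ℝ) 1 - 1 +
      (Fin.snoc (Fin.init z) t : Fin 2 → ℝ) 0) / (1 + (Fin.snoc (Fin.init z) t : Fin 2 → ℝ) 0))
      (2 / (1 + z 0)) (z 1)
    simp only [snoc2_zero, snoc2_one, init2_zero]
    have h := ((((hasDerivAt_id' (z 1)).const_mul 2).sub_const 1).add_const (z 0)).div_const (1 + z 0)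
    exact h.congr_deriv (by ring)
  · intro z hz
    have h0 := (hmem z hz).1
    positivity
  · intro y hy
    show (2 * (Fin.snoc y (hoE.f (y 0)) : Fin 2 → ℝ) 1 - 1 + (Fin.snoc y (hoE.f (y 0)) : Fin 2 → ℝ) 0) /
      (1 + (Fin.snoc y (hoE.f (y 0)) : Fin 2 → ℝ) 0) = zeroE.f (y 0)
    simp only [snoc2_zero, snoc2_one, hoE_f, zeroE_f]
    rw [div_eq_zero_iff]
    exact Or.inl (by ring)
  · intro y hy
    show (2 * (Fin.snoc y (oneE.f (y 0)) : Fin 2 → ℝ) 1 - 1 + (Fin.snoc y (oneE.f (y 0)) : Fin 2 → ℝ) 0) /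
      (1 + (Fin.snoc y (oneE.f (y 0)) : Fin 2 → ℝ) 0) = oneE.f (y 0)
    simp only [snoc2_zero, snoc2_one, oneE_f]
    have h1 : (1 : ℝ) + y 0 ≠ 0 := by have := (I01 hy).1; positivity
    rw [div_eq_one_iff_eq h1]
    ring
  · intro z hz
    obtain ⟨h0, h1, h2⟩ := hmem z hz
    rw [show U1hi.integrand = U1.fn from rfl, RFun.rep_integrand]
    simp only [RFun.fn, U1, U2r, QU1, QU2, map_add, map_sub, map_mul, map_ofNat, map_one, aeval_X, snoc2_zero,
      snoc2_one, init2_zero]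
    have hA : (1 : ℝ) + z 0 ≠ 0 := by positivity
    have hz1 : (0 : ℝ) ≤ z 1 := le_trans (by linarith [(mem_sbDom.1 (show z ∈ sbDom hoE oneE from hz)).1.2]) h1
    have hB' : (0 : ℝ) < 1 + z 0 * z 1 := by nlinarith [mul_nonneg h0 hz1]
    have hE : (2 : ℝ) - z 0 + z 0 * ((2 * z 1 - 1 + z 0) / (1 + z 0)) = 2 * (1 + z 0 * z 1) / (1 + z 0) := by
      field_simp; ring
    rw [hE]
    have hB := hB'.ne'
    field_simp
    try ring

/-- **`[SLc 1] ≡ [U1] − [U2r]`**: `[□², (1−w)/(2 + w(1−w)σ)] ≡ [□², 1/(1+wσ)] − [□², 1/(2 − w + wσ)]`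
(`log²2/2 = π²/12 − Li₂(½)`). -/
theorem sLc_one_split : KZ.of (SLc 1 (by norm_num)).rep - KZ.of U1.rep + KZ.of U2r.rep ∈ KZ.relations := by
  have h1 := u1_cut
  have h2 := u1lo_shift
  have h3 := sLc_one_shift
  have h4 := u1hi_U2r
  convert sub_mem (sub_mem (sub_mem h3 h2) h1) h4 using 1
  abel

/-- **A-side of row #18 over the strips**: `[A18] ≡ [U1] − [U2r] + [SL]`, i.e.
`[□², 1/(2−x+y+x²−y²)] ≡ [□², 1/(1+xy)] − [□², 1/(2−x+xy)] + [□², (1/2)(1−x)/(1 − xy/2 + x²y/2)]`. -/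
theorem a18_strips : KZ.of A18.rep - KZ.of U1.rep + KZ.of U2r.rep - KZ.of SL.rep ∈ KZ.relations := by
  have h1 := a18_box
  have h2 := sLc_one_split
  have h3 := sLc_neg_one_SL
  convert add_mem (add_mem h1 h2) h3 using 1
  abel

/-! ## B-attachment over boxes (NODE addendum 8n): `[B18] ≡ [K12c] − [Kh]`

`K12c = [□², 1/(1 + 2x² + x(2y − 1))]` (`= K(1,2)/2`; verbatim the `K12c` of `TelescopeCube.Strips`, where
`K_strip : [K12c] ≡ [Sp] + [Sm]`) and `Kh = [□², 1/(2 + x² + x(2y − 1))]` (`= K(½,½)/2`, `Kh_strip` there).  Moves: the base cut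
of `K12c` at `x = ½` (`gcut`); its right half is `S18h` under `(x, y) ↦ (2x − 1, 2x − 1 + 2y)` (`rel_affine`,
`|det| = 4`); its left half is `Kh` under `(x, y) ↦ (x/2, y)` (`rel_affine`, `|det| = ½`); and `b18_affine`.
No Cayley/Möbius step and no `J`-family is needed on the B-side. -/

/-- Auxiliary definition `K12cDen`: K12c Den. [bookkeeping] -/
def K12cDen : MvPolynomial (Fin 2) ℚ := C 1 + C 2 * X 0 * X 0 + X 0 * (C 2 * X 1 - C 1)

/-- Auxiliary step `K12cDen_pos`: K12c Den pos. [bookkeeping] -/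
theorem K12cDen_pos {x : Fin 2 → ℝ} (hx : x ∈ cube 2) : 0 < aeval x K12cDen := by
  have h0 := (hx 0).1; have h1 := (hx 1).1
  simp only [K12cDen, map_add, map_sub, map_mul, aeval_C, aeval_X, eq_ratCast, Rat.cast_one, Rat.cast_ofNat]
  nlinarith [mul_nonneg h0 h1, sq_nonneg (x 0 - 1 / 4)]

/-- `K12c = [□², 1/(1 + 2x² + x(2y − 1))]`, verbatim as in `TelescopeCube.Strips`. -/
def K12c : RFun 2 := ⟨C 1, K12cDen, fun _ hx => (K12cDen_pos hx).ne'⟩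

/-- Auxiliary definition `KhDen`: Kh Den. [bookkeeping] -/
def KhDen : MvPolynomial (Fin 2) ℚ := C 2 + X 0 * X 0 + X 0 * (C 2 * X 1 - C 1)

/-- Auxiliary step `KhDen_pos`: Kh Den pos. [bookkeeping] -/
theorem KhDen_pos {x : Fin 2 → ℝ} (hx : x ∈ cube 2) : 0 < aeval x KhDen := by
  have h0 := (hx 0).1; have h0' := (hx 0).2; have h1 := (hx 1).1
  simp only [KhDen, map_add, map_sub, map_mul, aeval_C, aeval_X, eq_ratCast, Rat.cast_one, Rat.cast_ofNat]
  nlinarith [mul_nonneg h0 h1, sq_nonneg (x 0)]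

/-- `Kh = [□², 1/(2 + x² + x(2y − 1))]` (`= K(½,½)/2`), verbatim as in `TelescopeCube.Strips` (`Kh_strip`). -/
def Kh : RFun 2 := ⟨C 1, KhDen, fun _ hx => (KhDen_pos hx).ne'⟩

/-- Auxiliary step `K12c_fn`: K12c fn. [bookkeeping] -/
theorem K12c_fn (z : Fin 2 → ℝ) : K12c.fn z = 1 / (1 + 2 * z 0 * z 0 + z 0 * (2 * z 1 - 1)) := by
  simp only [RFun.fn, K12c, K12cDen, map_add, map_sub, map_mul, aeval_C, aeval_X, eq_ratCast, Rat.cast_one,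
    Rat.cast_ofNat]

/-- Auxiliary step `Kh_fn`: Kh fn. [bookkeeping] -/
theorem Kh_fn (z : Fin 2 → ℝ) : Kh.fn z = 1 / (2 + z 0 * z 0 + z 0 * (2 * z 1 - 1)) := by
  simp only [RFun.fn, Kh, KhDen, map_add, map_sub, map_mul, aeval_C, aeval_X, eq_ratCast, Rat.cast_one,
    Rat.cast_ofNat]

/-- Auxiliary step `hK12c`: h K12c. [bookkeeping] -/
theorem hK12c : K12c.rep.domain = sbDom zeroE oneE := by rw [RFun.rep_domain, cube_eq_sbDom]

/-- The halves of `K12c` left and right of `x = ½`. -/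
def KL : KZ.IntegralRep 2 := GB K12c.rep zeroE oneE hK12c 0 (1 / 2) le_rfl (by norm_num)
/-- Auxiliary definition `KR`: KR. [bookkeeping] -/
def KR : KZ.IntegralRep 2 := GB K12c.rep zeroE oneE hK12c (1 / 2) 1 (by norm_num) le_rfl

/-- (k1) base cut at `x = ½` (rule 1a). -/
theorem k_cut : KZ.of K12c.rep - KZ.of KL - KZ.of KR ∈ KZ.relations :=
  gcut K12c.rep zeroE oneE hK12c (1 / 2) (by norm_num) (by norm_num)

/-- Auxiliary step `inv_eq_inv_mul_four`: inv eq inv mul four. [bookkeeping] -/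
theorem inv_eq_inv_mul_four {A B : ℝ} (hA : 0 < A) (hB : B = 4 * A) : 1 / A = 1 / B * 4 := by
  rw [hB]; field_simp

/-- Auxiliary step `inv_eq_inv_mul_half`: inv eq inv mul half. [bookkeeping] -/
theorem inv_eq_inv_mul_half {A B : ℝ} (hA : 0 < A) (hB : 2 * B = A) : 1 / A = 1 / B * (1 / 2) := by
  have hB0 : B ≠ 0 := by intro h; rw [h] at hB; linarith
  rw [← hB]; field_simp

/-- (k2) the right half is `S18h`: `(x, y) ↦ (2x − 1, 2x − 1 + 2y)`, `|det| = 4`. -/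
theorem kR_S18h : KZ.of KR - KZ.of S18h ∈ KZ.relations := by
  refine rel_affine KR S18h !![2, 0; 2, 2] ![-1, -1]
    (fun z => ![(2 : ℝ) * z 0 + 0 * z 1 + (-1), 2 * z 0 + 2 * z 1 + (-1)]) (fun z i => by fin_cases i <;> simp)
    (by rw [Matrix.det_fin_two_of]; norm_num) ?_ fun z hz => ?_
  · ext w
    rw [show S18h.domain = sbDom idE tp2E from rfl, mem_S_domain, show KR.domain = gband (1 / 2) 1 zeroE oneE from rfl]
    simp only [mem_image, mem_gband, zeroE_f, oneE_f]
    constructor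
    · rintro ⟨⟨h0, h0'⟩, h1, h2⟩
      refine ⟨![(w 0 + 1) / 2, (w 1 - w 0) / 2], ?_, ?_⟩
      · simp only [Matrix.cons_val_zero, Matrix.cons_val_one]
        push_cast
        refine ⟨⟨?_, ?_⟩, ?_, ?_⟩ <;> linarith
      · funext i
        fin_cases i
        · simp only [Fin.zero_eta, Fin.isValue, Matrix.cons_val_zero, Matrix.cons_val_one]; ring
        · simp only [Fin.mk_one, Fin.isValue, Matrix.cons_val_one, Matrix.cons_val_zero]; ring
    · rintro ⟨z, ⟨⟨h0, h0'⟩, h1, h2⟩, rfl⟩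
      simp only [Matrix.cons_val_zero, Matrix.cons_val_one]
      push_cast at h0 h0'
      refine ⟨⟨?_, ?_⟩, ?_, ?_⟩ <;> linarith
  · have hz' : z ∈ gband (1 / 2) 1 zeroE oneE := hz
    rw [mem_gband, zeroE_f, oneE_f] at hz'
    push_cast at hz'
    obtain ⟨⟨h0, _⟩, h1, _⟩ := hz'
    have habs : |((!![2, 0; 2, 2] : Matrix (Fin 2) (Fin 2) ℚ).det : ℝ)| = 4 := by
      rw [Matrix.det_fin_two_of]; norm_num
    rw [habs, show KR.integrand = K12c.fn from rfl, K12c_fn, S18h_integrand]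
    simp only [Matrix.cons_val_zero, Matrix.cons_val_one]
    have hA : (0 : ℝ) < 1 + 2 * z 0 * z 0 + z 0 * (2 * z 1 - 1) := by
      nlinarith [mul_nonneg (by linarith : (0 : ℝ) ≤ z 0) h1]
    exact inv_eq_inv_mul_four hA (by ring)

/-- (k3) the left half is `Kh`: `(x, y) ↦ (x/2, y)`, `|det| = ½`. -/
theorem kh_KL : KZ.of Kh.rep - KZ.of KL ∈ KZ.relations := by
  refine rel_affine Kh.rep KL !![1 / 2, 0; 0, 1] ![0, 0]
    (fun z => ![(1 / 2 : ℝ) * z 0 + 0 * z 1 + 0, 0 * z 0 + 1 * z 1 + 0]) (fun z i => by fin_cases i <;> simp)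
    (by rw [Matrix.det_fin_two_of]; norm_num) ?_ fun z hz => ?_
  · ext w
    rw [show KL.domain = gband 0 (1 / 2) zeroE oneE from rfl, mem_gband, zeroE_f, oneE_f, RFun.rep_domain]
    simp only [mem_image]
    push_cast
    constructor
    · rintro ⟨⟨h0, h0'⟩, h1, h2⟩
      refine ⟨![2 * w 0, w 1], ?_, ?_⟩
      · rw [cube_eq_sbDom, mem_sbDom, zeroE_f, oneE_f]
        simp only [Matrix.cons_val_zero, Matrix.cons_val_one]
        refine ⟨⟨?_, ?_⟩, ?_, ?_⟩ <;> linarith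
      · funext i
        fin_cases i
        · simp only [Fin.zero_eta, Fin.isValue, Matrix.cons_val_zero, Matrix.cons_val_one]; ring
        · simp only [Fin.mk_one, Fin.isValue, Matrix.cons_val_one, Matrix.cons_val_zero]; ring
    · rintro ⟨z, hz, rfl⟩
      rw [cube_eq_sbDom, mem_sbDom, zeroE_f, oneE_f] at hz
      obtain ⟨⟨h0, h0'⟩, h1, h2⟩ := hz
      simp only [Matrix.cons_val_zero, Matrix.cons_val_one]
      refine ⟨⟨?_, ?_⟩, ?_, ?_⟩ <;> linarith
  · have hz' := hz
    rw [RFun.rep_domain, cube_eq_sbDom, mem_sbDom, zeroE_f, oneE_f] at hz'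
    obtain ⟨⟨h0, _⟩, h1, _⟩ := hz'
    have habs : |((!![1 / 2, 0; 0, 1] : Matrix (Fin 2) (Fin 2) ℚ).det : ℝ)| = 1 / 2 := by
      rw [Matrix.det_fin_two_of]; norm_num
    rw [habs, RFun.rep_integrand, Kh_fn, show KL.integrand = K12c.fn from rfl, K12c_fn]
    simp only [Matrix.cons_val_zero, Matrix.cons_val_one]
    have hA : (0 : ℝ) < 2 + z 0 * z 0 + z 0 * (2 * z 1 - 1) := by nlinarith [mul_nonneg h0 h1]
    exact inv_eq_inv_mul_half hA (by ring)

/-- **`[B18] ≡ [K12c] − [Kh]`**: `[□², 1/(2+x+2y+x²+2xy)] ≡ [□², 1/(1+2x²+x(2y−1))] − [□², 1/(2+x²+x(2y−1))]`. -/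
theorem b18_strips : KZ.of B18.rep - KZ.of K12c.rep + KZ.of Kh.rep ∈ KZ.relations := by
  have h1 := b18_affine
  have h2 := k_cut
  have h3 := kR_S18h
  have h4 := kh_KL
  convert add_mem (sub_mem (sub_mem h1 h2) h3) h4 using 1
  abel

/-- **Row #18 over seven strips** (all `[□², r]` with `r` rational, denominator quadratic in `x`, LINEAR in `y`):
`[A18] − 2•[B18] ∈ KZ.relations ↔ [U1] − [U2r] + [SL] − 2•[K12c] + 2•[Kh] ∈ KZ.relations`, i.e.
`#18 ⟺ [□²,1/(1+xy)] − [□²,1/(2−x+xy)] + [□²,(1/2)(1−x)/(1−xy/2+x²y/2)] ≡ 2[□²,1/(1+2x²+x(2y−1))] − 2[□²,1/(2+x²+x(2y−1))]`. -/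
theorem pair18_iff_strips : KZ.of A18.rep - 2 • KZ.of B18.rep ∈ KZ.relations ↔
    KZ.of U1.rep - KZ.of U2r.rep + KZ.of SL.rep - 2 • KZ.of K12c.rep + 2 • KZ.of Kh.rep ∈ KZ.relations := by
  have hB : (2 : ℕ) • (KZ.of B18.rep - KZ.of K12c.rep + KZ.of Kh.rep) ∈ KZ.relations :=
    AddSubgroup.nsmul_mem _ b18_strips 2
  have key : (KZ.of A18.rep - 2 • KZ.of B18.rep) -
      (KZ.of U1.rep - KZ.of U2r.rep + KZ.of SL.rep - 2 • KZ.of K12c.rep + 2 • KZ.of Kh.rep) ∈ KZ.relations := by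
    have h := sub_mem a18_strips hB
    convert h using 1
    simp only [smul_sub, smul_add]
    abel
  constructor
  · intro h
    have h' := sub_mem h key
    convert h' using 1
    abel
  · intro h
    have h' := add_mem h key
    convert h' using 1
    abel

end Summit.KontsevichZagierPeriods.RootDecompQuadraticDescent.Pair18
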